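import Literature.Computability.Learning.NaturalLearningTables
import HarnessLib

/-!
# NW predictor tables for a general column design

Groundwork for the named fact `Literature.Computability.Learning.cikk_learn_AC0Mod` (CIKK 2016,
Cor. 5.4). `NaturalLearningTables.lean` models the TABLES with which the hypothesis evaluator of
the CIKK learner computes the NW predictor (CIKK §2.4, preprocessing step 4 and
circuit-construction step 2) for the prime-field design of the `P/poly` learner. Its combinatorial
layer depends on the design only through a COLUMN-VALUE function: block `i` is the graph
`τ ↦ (τ, cv i τ)` of a function on the columns. This file factors that layer once over an
arbitrary column-value function `cv : Fin (2^ℓ) → ℕ → ℕ`, so that every column design (the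
prime-field design, the `AC⁰[p]`-computable design over `𝔽_p[X]/(P)` of `ModpTables.lean`, …) is
an instance:

* `colMatch cv`, `mixInput`, `matching`, `rank`, `idxOf`, `patInput`, `matchingList`, `tableList`
  and the lemmas `length_matchingList`, `length_filter_matchingList_lt`, `testBit_idxOf`,
  `patInput_idxOf`, `idxOf_lt`, `tableList_getD_idxOf` (statements and proofs as in
  `NaturalLearningTables.lean`, with `cv` carried instead of the field size);
* `IsColumnDesign cv e` — two positions of the design `e` coincide iff they are in the same
  column with matching column values — and its consequences `mem_range_iff_colMatch`,
  `extend_comp_eq_mixInput`, `card_matching_le` (from the NW design property) and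
  **`nwPredictor_eq_predictOfTables`**.

## References

* M. Carmosino, R. Impagliazzo, V. Kabanets, A. Kolokolova, *Learning algorithms from natural
  proofs*, CCC 2016, §2.4 (NW reconstruction algorithm), §3.1 [CarmosinoImpagliazzoKabanetsKolokolova2016].
* N. Nisan, A. Wigderson, *Hardness vs randomness*, JCSS 49 (1994), Lemma 2.5 (the design as graphs
  of low-degree polynomials) [NisanWigderson1994].
-/

namespace Literature.Computability.Learning

namespace ColDesign

open Literature.Computability.Complexity Literature.Computability.MetaComplexity _root_.Computability Finset

variable {ℓ : ℕ} (cv : Fin (2 ^ ℓ) → ℕ → ℕ)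

/-- Blocks `i` and `j` **match in column `τ`**: their column values agree. [folklore] -/
def colMatch (i j : Fin (2 ^ ℓ)) (τ : ℕ) : Prop := cv i τ = cv j τ

/-- `colMatch` is decidable. [folklore] -/
instance (i j : Fin (2 ^ ℓ)) (τ : ℕ) : Decidable (colMatch cv i j τ) := by
  unfold colMatch; infer_instance

/-- **The restriction of the completed seed to block `j`**: `x` on the matching columns, `z`
elsewhere. [cite: CarmosinoImpagliazzoKabanetsKolokolova2016, §2.4 (circuit construction, steps 1–2)] -/
def mixInput {m n' : ℕ} (e : Fin (2 ^ ℓ) → (Fin n' ↪ Fin m)) (i j : Fin (2 ^ ℓ))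
    (z : Fin m → Bool) (x : Fin n' → Bool) : Fin n' → Bool :=
  fun τ => if colMatch cv i j τ then x τ else z (e j τ)

/-- The matching columns of blocks `i`, `j` (as a finset of `Fin n'`). [folklore] -/
def matching (n' : ℕ) (i j : Fin (2 ^ ℓ)) : Finset (Fin n') := univ.filter fun τ => colMatch cv i j τ

/-- The rank of column `τ` among the matching columns: the number of matching columns before it.
[folklore] -/
def rank (i j : Fin (2 ^ ℓ)) (τ : ℕ) : ℕ :=
  ((range τ).filter fun τ' => colMatch cv i j τ').card

/-- The matching pattern of `x` read as a number: bit `rank τ` is `x τ` for matching `τ`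
(`bitsToNat` of the matching bits in column order). [folklore] -/
def idxOf (n' : ℕ) (i j : Fin (2 ^ ℓ)) (x : Fin n' → Bool) : ℕ :=
  bitsToNat (((List.finRange n').filter fun τ : Fin n' => decide (colMatch cv i j (τ : ℕ))).map x)

/-- The input of block `j` under the pattern number `c`: bit `rank τ` of `c` on matching columns,
`z` elsewhere. [cite: CarmosinoImpagliazzoKabanetsKolokolova2016, §2.4 (preprocessing, step 4)] -/
def patInput {m n' : ℕ} (e : Fin (2 ^ ℓ) → (Fin n' ↪ Fin m)) (i j : Fin (2 ^ ℓ))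
    (z : Fin m → Bool) (c : ℕ) : Fin n' → Bool :=
  fun τ => if colMatch cv i j τ then c.testBit (rank cv i j τ) else z (e j τ)

/-! ### Bits of `bitsToNat`, positions in sorted lists -/

/-- The matching columns as a sorted list. [folklore] -/
def matchingList (n' : ℕ) (i j : Fin (2 ^ ℓ)) : List (Fin n') :=
  (List.finRange n').filter fun τ : Fin n' => decide (colMatch cv i j (τ : ℕ))

/-- The matching list enumerates the matching finset. [folklore] -/
theorem length_matchingList (i j : Fin (2 ^ ℓ)) (n' : ℕ) :
    (matchingList cv n' i j).length = (matching cv n' i j).card := by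
  rw [matchingList, matching, ← List.toFinset_card_of_nodup ((List.nodup_finRange n').filter _)]
  congr 1
  ext τ
  simp

/-- The elements of the matching list below `τ` are `rank τ` many. [folklore] -/
theorem length_filter_matchingList_lt (i j : Fin (2 ^ ℓ)) {n' : ℕ} (τ : Fin n') :
    ((matchingList cv n' i j).filter fun b => decide (b < τ)).length = rank cv i j τ := by
  rw [matchingList, List.filter_filter, rank,
    ← List.toFinset_card_of_nodup ((List.nodup_finRange n').filter _)]
  -- compare the two finsets through `Fin.val`
  rw [← Finset.card_map Fin.valEmbedding]
  congr 1
  ext t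
  simp only [Finset.mem_map, List.mem_toFinset, List.mem_filter, List.mem_finRange, true_and,
    Bool.and_eq_true, decide_eq_true_eq, Fin.valEmbedding_apply, Finset.mem_filter,
    Finset.mem_range]
  constructor
  · rintro ⟨σ, ⟨h1, h2⟩, rfl⟩
    exact ⟨h1, h2⟩
  · rintro ⟨h1, h2⟩
    exact ⟨⟨t, lt_trans h1 τ.isLt⟩, ⟨h1, h2⟩, rfl⟩

/-- **Reading the pattern number**: for a matching column `τ`, bit `rank τ` of `idxOf x` is `x τ`.
[folklore] -/
theorem testBit_idxOf {n' : ℕ} (i j : Fin (2 ^ ℓ)) (x : Fin n' → Bool) (τ : Fin n')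
    (hτ : colMatch cv i j τ) : (idxOf cv n' i j x).testBit (rank cv i j τ) = x τ := by
  have hmem : τ ∈ matchingList cv n' i j := by
    simp [matchingList, hτ]
  have hsorted : (matchingList cv n' i j).Pairwise (· < ·) :=
    (List.pairwise_lt_finRange n').filter _
  obtain ⟨h, hget⟩ := get_length_filter_lt _ hsorted τ hmem
  rw [idxOf, Com.testBit_bitsToNat, ← matchingList, ← length_filter_matchingList_lt cv i j τ,
    List.getD_eq_getElem _ _ (by simpa using h), List.getElem_map, hget]

/-- **The pattern of `x` reproduces the mixed input**: `patInput (idxOf x) = mixInput x`.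
[cite: CarmosinoImpagliazzoKabanetsKolokolova2016, §2.4 (table lookup)] -/
theorem patInput_idxOf {m n' : ℕ} (e : Fin (2 ^ ℓ) → (Fin n' ↪ Fin m)) (i j : Fin (2 ^ ℓ))
    (z : Fin m → Bool) (x : Fin n' → Bool) :
    patInput cv e i j z (idxOf cv n' i j x) = mixInput cv e i j z x := by
  funext τ
  simp only [patInput, mixInput]
  split_ifs with h
  · exact testBit_idxOf cv i j x τ h
  · rfl

/-- The pattern number is below `2^{#matching}`. [folklore] -/
theorem idxOf_lt {n' : ℕ} (i j : Fin (2 ^ ℓ)) (x : Fin n' → Bool) :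
    idxOf cv n' i j x < 2 ^ (matching cv n' i j).card := by
  rw [← length_matchingList, idxOf, ← matchingList]
  simpa using bitsToNat_lt ((matchingList cv n' i j).map x)

/-! ### The tables and the predictor read off them -/

/-- **The table of block `j`** (relative to the challenge block `i` and the seed `z`): the values
of `g` on the `2^{#matching}` pattern inputs.
[cite: CarmosinoImpagliazzoKabanetsKolokolova2016, §2.4 (preprocessing, step 4: "build the table `T`")] -/
def tableList {m n' : ℕ} (e : Fin (2 ^ ℓ) → (Fin n' ↪ Fin m)) (g : (Fin n' → Bool) → Bool)
    (i j : Fin (2 ^ ℓ)) (z : Fin m → Bool) : List Bool :=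
  List.ofFn fun c : Fin (2 ^ (matching cv n' i j).card) => g (patInput cv e i j z c)

/-- **Table lookup at the pattern of `x` returns `g` on the mixed input.**
[cite: CarmosinoImpagliazzoKabanetsKolokolova2016, §2.4 (circuit construction, step 2)] -/
theorem tableList_getD_idxOf {m n' : ℕ} (e : Fin (2 ^ ℓ) → (Fin n' ↪ Fin m))
    (g : (Fin n' → Bool) → Bool) (i j : Fin (2 ^ ℓ)) (z : Fin m → Bool) (x : Fin n' → Bool) :
    (tableList cv e g i j z).getD (idxOf cv n' i j x) false = g (mixInput cv e i j z x) := by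
  rw [tableList, List.getD_eq_getElem _ _ (by simpa using idxOf_lt cv i j x), List.getElem_ofFn,
    ← patInput_idxOf cv e i j z x]

/-! ### Column designs -/

/-- **`e` is a column design with column values `cv`**: two positions coincide iff they are in
the same column and the column values of the two blocks agree there (the graphs
`τ ↦ (τ, cv i τ)`). [cite: NisanWigderson1994, Lemma 2.5] -/
def IsColumnDesign {m n' : ℕ} (e : Fin (2 ^ ℓ) → (Fin n' ↪ Fin m)) : Prop :=
  ∀ i j : Fin (2 ^ ℓ), ∀ s τ : Fin n', e i s = e j τ ↔ s = τ ∧ colMatch cv i j τ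

variable {cv} {m n' : ℕ} {e : Fin (2 ^ ℓ) → (Fin n' ↪ Fin m)}

/-- A position of block `j` lies in block `i` iff the columns match. [folklore] -/
theorem mem_range_iff_colMatch (he : IsColumnDesign cv e) (i j : Fin (2 ^ ℓ)) (τ : Fin n') :
    e j τ ∈ Set.range (e i) ↔ colMatch cv i j τ := by
  constructor
  · rintro ⟨s, hs⟩
    exact ((he i j s τ).1 hs).2
  · intro h
    exact ⟨τ, (he i j τ τ).2 ⟨rfl, h⟩⟩

/-- `z'|_{S_j} = mixInput` for a column design. [folklore] -/
theorem extend_comp_eq_mixInput (he : IsColumnDesign cv e) (i j : Fin (2 ^ ℓ)) (z : Fin m → Bool)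
    (x : Fin n' → Bool) :
    Function.extend (e i) x z ∘ (e j) = mixInput cv e i j z x := by
  funext τ
  simp only [Function.comp_apply, mixInput]
  split_ifs with h
  · rw [← (he i j τ τ).2 ⟨rfl, h⟩, (e i).injective.extend_apply]
  · rw [Function.extend_apply']
    intro ⟨s, hs⟩
    exact h ((he i j s τ).1 hs).2

/-- **Design property**: in a column design with intersections `≤ ℓ`, distinct blocks match in at
most `ℓ` columns. [cite: CarmosinoImpagliazzoKabanetsKolokolova2016, §3.1 (Thm. 3.3)] -/
theorem card_matching_le (he : IsColumnDesign cv e) (hdes : IsNWDesign ℓ e) {i j : Fin (2 ^ ℓ)} (hij : i ≠ j) :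
    (matching cv n' i j).card ≤ ℓ := by
  refine le_trans ?_ (hdes hij)
  -- `τ ↦ e j τ` maps the matching columns into `S_i ∩ S_j`
  refine Finset.card_le_card_of_injOn (fun τ => e j τ) (fun τ hτ => ?_) (fun τ _ τ' _ h => (e j).injective h)
  rw [mem_coe, matching, mem_filter] at hτ
  rw [mem_coe, mem_inter, mem_map, mem_map]
  exact ⟨⟨τ, mem_univ _, (he i j τ τ).2 ⟨rfl, hτ.2⟩⟩, ⟨τ, mem_univ _, rfl⟩⟩

/-- **The NW predictor over a column design is `predictOfTables`** with the tables `tableList` and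
the indices `idxOf`. [cite: CarmosinoImpagliazzoKabanetsKolokolova2016, Thm. 2.11 (reconstruction algorithm)] -/
theorem nwPredictor_eq_predictOfTables (he : IsColumnDesign cv e) (D : (Fin (2 ^ ℓ) → Bool) → Bool)
    (i : Fin (2 ^ ℓ)) (z : Fin m → Bool) (w : Fin (2 ^ ℓ) → Bool) (x : Fin n' → Bool) (g : (Fin n' → Bool) → Bool) :
    nwPredictor e g D i z w x =
      predictOfTables D i (fun j => tableList cv e g i j z) (fun j => idxOf cv n' i j x) w := by
  unfold nwPredictor predictFn predictOfTables hybrid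
  simp only [tableList_getD_idxOf, ← extend_comp_eq_mixInput he]

end ColDesign

end Literature.Computability.Learning
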